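import Summits.Parity.GeneralizedHardyLittlewood.Theorems.BeyondDiagonalBeatsQuarter.OffDiagCoreLedger
import HarnessLib

/-!
# Route `PrimeLevelFamEdge`, crux K_B (stmt-Parity-20343), line `diagonal_kernel_split` rev 4, plan Ω,
# worker key K2 (corollary) `OffDiagCoreLedgerHeight`: **K2 at L2's first height
# `Hf_ε₀ q d₁ d₂ α β c i = ⌈qc·D₁·q^{ε₀}/(2π)⌉` — hypothesis-free:
# `|offDiagCore Hf_ε₀ Δ′ q| ≤ q^{(5/4)(Δ′−1)+2ε₀+ε}·mainScaleReal Δ′ q` eventually**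

`OffDiagCoreLedger.abs_offDiagCore_le` bounds the finite dual core for every coordinatewise-admissible height
function. The height K1's (T) uses (the `hlen` shape of `OffDiagDualTruncationBox.tsum_tail_norm_fourier2_boxWeight_le`
and of `OffDiagCoreTruncationKit.boxTail_fst_le`),
`Hf_ε₀ q d₁ d₂ α β c i = ⌈(qc)·((1 + 4π√(αβ·2·2^{i₂})/(qc)·√(2·2^{i₁}))/(2^{i₁}/2))/(2π)·q^{ε₀}⌉`,
is admissible with `Λ₀ = 2/π` (`truncHeight_fst_le`, `natCeil_le_add_one`), whence
**`abs_offDiagCore_ceilHeight_le`**: for `0 < ε₀ ≤ 1`, `ε > 0` there is `q₀` with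
`|offDiagCore Hf_ε₀ Δ′ q| ≤ q^{(5/4)(Δ′−1)+2ε₀+ε}·mainScaleReal Δ′ q` for all primes `q ≥ q₀` and `Δ′ ∈ (1,2]` —
the kernel number LIVE-Ω's savings on the finite dual core are quoted against (`κ₀ = 5/4`).
Bookkeeping; nothing about the heart. Helper (`--supports stmt-Parity-20343`); standard axioms.
«The programme SEARCHES and TYPES; no claim about Landau–Siegel zeros, Theorems 1–2 of arXiv:2211.02515 or
a repaired Margin232 until a kernel theorem says so.»
-/

noncomputable section

open Finset Polynomial
open scoped Real

namespace Summit.Parity.GeneralizedHardyLittlewood.Theorems.BeyondDiagonalBeatsQuarter.OffDiag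

open Literature.NumberTheory.LFunctions Literature.NumberTheory.LFunctions.KMV2000

/-- **L2's first height is coordinatewise admissible with `Λ₀ = 2/π`** (all indices, any level `q`).
[cite: KowalskiMichelVanderKam2000, Lemma 3.3 p. 9 — derivation] -/
theorem ceilHeight_admissible (q : ℕ) {ε₀ : ℝ} (α β c : ℕ) (i : ℕ × ℕ) :
    ((⌈((q * c : ℕ) : ℝ) * ((1 + 4 * π * Real.sqrt ((α : ℝ) * β * (2 * 2 ^ i.2)) / ((q : ℝ) * (c : ℝ)) *
        Real.sqrt (2 * 2 ^ i.1)) / ((2 : ℝ) ^ i.1 / 2)) / (2 * π) * (q : ℝ) ^ ε₀⌉₊ : ℕ) : ℝ) ≤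
      2 / π * ((q : ℝ) * (c : ℝ) * (1 + 4 * π * Real.sqrt ((α : ℝ) * (β : ℝ) * ((2 : ℝ) ^ i.1 * 2 ^ i.2)) /
        ((q : ℝ) * (c : ℝ))) * (q : ℝ) ^ ε₀) / (2 : ℝ) ^ i.1 + 1 := by
  have hD := truncHeight_fst_le (α := (α : ℝ)) (β := (β : ℝ)) (K₁ := (2 : ℝ) ^ i.1) (K₂ := (2 : ℝ) ^ i.2)
    (c := ((q * c : ℕ) : ℝ)) (den := (q : ℝ) * (c : ℝ)) (Q := (q : ℝ) ^ ε₀) (Nat.cast_nonneg _)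
    (Nat.cast_nonneg _) (by positivity) (by positivity) (Nat.cast_nonneg _) (by positivity) (by positivity)
  have hcast : ((q * c : ℕ) : ℝ) = (q : ℝ) * (c : ℝ) := by push_cast; ring
  refine natCeil_le_add_one (by positivity) (hD.trans (le_of_eq ?_))
  rw [hcast]

/-- **K2 at L2's first height.** For `0 < ε₀ ≤ 1` and `ε > 0` there is `q₀` such that for every prime
`q ≥ q₀` and every `Δ′ ∈ (1, 2]`:
`|offDiagCore Hf_ε₀ Δ′ q| ≤ q^{(5/4)(Δ′−1) + 2ε₀ + ε}·mainScaleReal Δ′ q`,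
`Hf_ε₀ q d₁ d₂ α β c i = ⌈(qc)·D₁·q^{ε₀}/(2π)⌉` L2's first height.
[cite: KowalskiMichelVanderKam2000, (21)–(23) p. 12, Lemma 3.3 p. 9, §6 p. 19; HardyWright2008, Thm. 315 — derivation] -/
theorem abs_offDiagCore_ceilHeight_le {ε₀ ε : ℝ} (hε₀ : 0 < ε₀) (hε₁ : ε₀ ≤ 1) (hε : 0 < ε) :
    ∃ q₀ : ℕ, ∀ (q : ℕ) [NeZero q], q₀ ≤ q → q.Prime → ∀ Δ' : ℝ, 1 < Δ' → Δ' ≤ 2 →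
      |offDiagCore (fun q' _ _ α β c i ↦ ⌈((q' * c : ℕ) : ℝ) * ((1 + 4 * π *
          Real.sqrt ((α : ℝ) * β * (2 * 2 ^ i.2)) / ((q' : ℝ) * (c : ℝ)) * Real.sqrt (2 * 2 ^ i.1)) /
          ((2 : ℝ) ^ i.1 / 2)) / (2 * π) * (q' : ℝ) ^ ε₀⌉₊) Δ' q| ≤
        (q : ℝ) ^ (5 / 4 * (Δ' - 1) + 2 * ε₀ + ε) * mainScaleReal Δ' q := by
  obtain ⟨q₀, hq₀⟩ := abs_offDiagCore_le (Λ₀ := 2 / π) (by positivity) hε₀ hε₁ hε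
  refine ⟨q₀, fun q _ hq hprime Δ' h1 h2 ↦ ?_⟩
  exact hq₀ q hq hprime Δ' h1 h2 _ fun _ _ α β c i ↦ ceilHeight_admissible q α β c i

end Summit.Parity.GeneralizedHardyLittlewood.Theorems.BeyondDiagonalBeatsQuarter.OffDiag
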